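import Mathlib
import HarnessLib

/-!
# Venture HSemireg — the FRAME LEMMA and LEMMA (M) of the g = 8 family-A flat-menu census (rows A17-J9 ∕ J10 ∕ J11): a tight
# frame `Σ_j P_j P_j† = 4·I` with PRIMITIVE members has no entry of norm 4, every member has `|P|² ≤ 4` (θ-degree `δ ≤ 8`) and
# occurs at most `4 ∕ |P|²` times, and the Gram matrix satisfies `Γ² = 4Γ` — kernel linear algebra over `ℤ` and `ℤ[i]`

HONEST FRAMING. Part of the Lean index of the computation cell `pub-hsemireg` (Sunday typer seat p9, § g = 8; companion of
`CensusG8Table.lean` ∕ `CensusG8Verdict.lean`, census rows **A17-J9, A17-J10, A17-J11** of `target-g8/CENSUS.md` v1.274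
`7744dc4867915f69` — family A, n = 4, door (4) «hunt representatives», all three «NOT-AN-OBJECT (menu empty)»; companions
`FlatMenuFrameInstances.lean` and `FlatMenuFrameCounts.lean`). LINEAR ALGEBRA ONLY: finite families of vectors over a commutative
star-ring with an integer-valued norm (instances elsewhere: `ℤ`, and `ℤ[i]` with conjugation) and one matrix identity. No abelian variety,
subsurface, Plücker embedding, cycle class or dualising sheaf is constructed; the DICTIONARY below is TEXT OF RECORD, not a binder of
any theorem; the machine censuses (4475 ∕ 19283 ∕ 137612 ∕ 768 231 ∕ 1 188 017 class solutions and their Stage-B verdicts) stay machine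
and are NOT reproduced; nothing here says that HC ∕ HC_CM ∕ HC_AV holds; no object is certified; no Literature fact is declared.

TEXTS OF RECORD (quoted, not interpreted). Source: t-17 g7, `target-g8/FAMILY-A-G8-t17-g7.md` v1.7 `30f228fa15a40313` §4.7 (setting),
§4.7.5 (FRAME LEMMA), §4.7.6 (LEMMA (M)), §4.9 (5) (the O_K frame identity); hand ×2 reads by th-1 g39, INBOX l.7245 (frame lemma)
and l.7642 (LEMMA (M) (i)–(iv)); the frame formulation was reached independently on code B by t-18 g7 (INBOX l.7002).
* DICTIONARY (prose only): X = E⁴ (resp. E_K⁴, End E_K = O_K = ℤ[i], ℤ[ω]) with the product polarisation θ; an abelian subsurface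
  through 0 is B_W = W ⊗ E, W ⊂ ℤ⁴ (resp. O_K⁴) a saturated plane; P(W) ∈ ℤ⁶ (resp. O_K⁶) is the Plücker vector of the annihilator
  W^⊥ — «it is PRIMITIVE (W^⊥ is saturated), lies on the Klein quadric …, and W ↦ ±P(W) is injective»; «δ_W := θ²·[B_W] = 2·|P(W)|²»;
  «the class equation Σ_j [B_{W_j}] = 2θ² (members counted with multiplicity) is EQUIVALENT to the FRAME IDENTITY Σ_j P(W_j)·P(W_j)ᵀ
  = 4·I₆ (36 integer equations; its trace is Σ_j δ_{W_j} = 48)»; over O_K «the Hermitian frame identity Σ_j P(W_j)·P(W_j)† = 4·I₆».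
* FRAME LEMMA (§4.7.5, hand ×2): «In every class solution every member has all P_ab(W_j) ∈ {0, ±1} … Proof: the diagonal entry
  (ab, ab) reads Σ_j P_ab(W_j)² = 4, so |P_ab| ≤ 2, and P_ab(W) = ±2 forces P_ab(W′) = 0 for every other member W′; then for cd ≠ ab
  the entry (ab, cd) reads P_ab(W)·P_cd(W) + 0 = 0, so P(W) = ±2·e_ab, not primitive — contradiction.» §4.9 (5): «exactly as in
  §4.7.5, N(P_ab) = 4 is impossible, so every member of a class solution has all N(P_ab(W_j)) ≤ 3: P_ab ∈ {0} ∪ O_K^× ∪ (1+i)·O_K^×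
  for ℤ[i] (norms 0, 1, 2) and P_ab ∈ {0} ∪ O_K^× ∪ (1−ω)·O_K^× for ℤ[ω] (norms 0, 1, 3).»
* LEMMA (M) (§4.7.6, hand ×2): «Fix a member W with Plücker vector P, occurring n_W times. Then n_W·|P|⁴ ≤ Σ_j |⟨P_j, P⟩|² =
  P†(Σ_j P_jP_j†)P = 4·|P|² … Hence n_W·|P|² ≤ 4, and since δ_W = 2·|P(W)|²: (i) EVERY MEMBER OF EVERY CLASS SOLUTION HAS θ-DEGREE
  δ_W ≤ 8 — on E⁴ for every E and at the CM anchors alike, integral or not; (ii) n_W·δ_W ≤ 8 …; (iii) Σ_{j ≠ copies of W} |⟨P_j, P⟩|²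
  = |P|²·(4 − n_W|P|²) …; (iv) GRAM FORM: the m × m Gram matrix Γ = (⟨P_j, P_k⟩) … satisfies Γ² = 4Γ [A := (P_1 … P_m), AA† = 4·I₆ ⇒
  (A†A)² = 4·A†A]. CONSEQUENCES. (a) … a member of an integral class solution has P ∈ {0, ±1}⁶ and #supp P = |P|² ≤ 4, so it is
  one of the 74 planes of degree ≤ 8.»

WHAT THIS FILE PROVES (kernel), for an ARBITRARY frame constant `c : ℕ` (the censuses: `c = 4`; the E₈ door §4.10 (E8-i): `c = 16`
after clearing the denominator of `q_j ∈ ½O_K⁶`). §0 vocabulary: `Primitive`, `IsFrame c P` (`Σ_j P j a * star (P j b) = c·δ_ab`,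
any finite index types), `normSq N v = Σ_a N(v a)` («|P|²»), `pair`, `copies` («n_W» = its cardinality), `memberMatrix`. §1 ABSTRACT
FRAME LEMMA for `R` a commutative star-ring of characteristic 0 and `N : R → ℤ` with `0 ≤ N x`, `x * star x = N x`, `N x = 0 → x = 0`:
`sum_norm_slot` (Σ_j N(P_j a) = c), `norm_le`, `eq_zero_of_norm_eq` ∕ `entry_eq_zero_of_norm_eq` (an entry of norm c monopolises its
slot, then — without zero divisors — its vector), **`norm_ne_of_primitive`** ∕ **`norm_lt_of_primitive`** (c ≠ 1; units have norm 1)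
and the census form **`norm_le_three_of_primitive`** (c = 4). §2 ABSTRACT LEMMA (M): `sum_normSq_eq` (trace line Σ_j |P_j|² =
c·#slots), `sum_norm_pair_eq` (Σ_j N⟨P_j, v⟩ = c|v|², every v), **`card_copies_mul_normSq_le`** (n_W·|P|² ≤ c), `normSq_le` ((i)),
`card_copies_mul_delta_le` ((ii)), `sum_norm_pair_noncopies` ∕ `pair_eq_zero_of_normSq_eq` ((iii): a member with |P|² = c is
orthogonal to every other member); §3 `isFrame_iff_matrix` and **`gram_mul_gram`** ((iv), any star-ring, any scalar). The INSTANCES `R = ℤ`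
(trivial star, `N x = x·x`: at c = 4 entries in {0, ±1}, #supp ≤ 4) and `R = ℤ[i]` (`N = Zsqrtd.norm`: at c = 4 norms 0, 1, 2,
|P|² ≤ 4) are the companion file `FlatMenuFrameInstances.lean`; the support counts 122 ∕ 74 over `{0,±1}⁶` are `FlatMenuFrameCounts.lean`.

WHAT IS NOT HERE. The dictionary (primitivity ∕ decomposability of P(W), δ_W = 2|P|², class equation ⟺ frame identity), (H8), Stage B,
THEOREMS (α16) ∕ (α16⁺) ∕ (α17) ∕ (α17⁺) themselves (machine censuses of record), the O_K universes 8006 ∕ 28698 ∕ 710 ∕ 618, and the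
Eisenstein instance (Mathlib has no bundled star-ring `ℤ[ω]`; §1–§2 apply verbatim to any such structure with its norm).
-/

namespace Summit.Ventures.HSemireg.FlatFrame

open Finset
open scoped Matrix

/-! ## §0 Vocabulary (definitions carry only the structure they use) -/

section Defs

variable {R : Type*} {ι κ : Type*}

/-- A vector is PRIMITIVE when every common divisor of its entries is a unit (over a PID: the entries generate the unit ideal;
for the Plücker vector of a saturated plane: «gcd of maximal minors = 1 (Smith)», th-1 l.7245). [definition of this file] -/
def Primitive [CommRing R] (v : ι → R) : Prop :=
  ∀ d : R, (∀ a, d ∣ v a) → IsUnit d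

/-- The (Hermitian) TIGHT-FRAME IDENTITY `Σ_j P_j P_j† = c·I` with frame constant `c : ℕ` for a finite family `P : κ → (ι → R)`,
entrywise `Σ_j P_j(a) · star (P_j(b)) = c·δ_ab`. The censuses use `c = 4`: t-17 §4.7.5's `Σ_j P(W_j)P(W_j)ᵀ = 4·I₆` over `ℤ`
(trivial star) and §4.9 (5)'s `Σ_j P(W_j)P(W_j)† = 4·I₆` over `O_K` (members listed with multiplicity as distinct indices `j`);
§4.10 (E8-i)'s `Σ_j n_j q_jq_j† = 4·I₆` with `q_j ∈ ½O_K⁶` becomes `c = 16` for `Q_j := 2q_j`. [definition of this file] -/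
def IsFrame [CommRing R] [StarRing R] [DecidableEq ι] [Fintype κ] (c : ℕ) (P : κ → ι → R) : Prop :=
  ∀ a b, ∑ j, P j a * star (P j b) = if a = b then (c : R) else 0

/-- The SQUARED NORM `|v|² := Σ_a N(v(a))` for a norm function `N` («δ_W = 2·|P(W)|²»). [definition of this file] -/
def normSq [Fintype ι] (N : R → ℤ) (v : ι → R) : ℤ := ∑ a, N (v a)

/-- The Hermitian pairing `⟨w, v⟩ := Σ_a w(a) · star (v(a))` (= `v† w`). [definition of this file] -/
def pair [CommRing R] [StarRing R] [Fintype ι] (w v : ι → R) : R := ∑ a, w a * star (v a)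

/-- The COPIES of `v` in the family: the indices `j` with `P_j = v`; their number is «n_W». [definition of this file] -/
def copies [Fintype ι] [Fintype κ] [DecidableEq R] (P : κ → ι → R) (v : ι → R) : Finset κ :=
  Finset.univ.filter (fun j => P j = v)

/-- The MEMBER MATRIX `A := (P_1 … P_m)`: column `j` is the vector `P_j`. [definition of this file] -/
def memberMatrix (P : κ → ι → R) : Matrix ι κ R := Matrix.of fun a j => P j a

/-- A primitive vector is non-zero (the zero vector has the non-unit common divisor `0`). -/
theorem ne_zero_of_primitive [CommRing R] [Nontrivial R] {v : ι → R} (hv : Primitive v) : v ≠ 0 := by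
  intro h0
  have h : IsUnit (0 : R) := hv 0 (fun a => by rw [h0]; exact dvd_zero 0)
  exact not_isUnit_zero h

end Defs

/-! ## §1 The FRAME LEMMA, abstract form (any frame constant `c`; the censuses: `c = 4`) -/

section FrameLemma

variable {R : Type*} [CommRing R] [StarRing R] [CharZero R]
variable {ι κ : Type*} [DecidableEq ι] [Fintype κ] {c : ℕ}
variable (N : R → ℤ) (hN0 : ∀ x, 0 ≤ N x) (hmul : ∀ x, x * star x = (N x : R)) (hz : ∀ x, N x = 0 → x = 0)

include hmul in
/-- DIAGONAL SLOT of the frame identity: `Σ_j N(P_j(a)) = c` («the diagonal entry (ab, ab) reads Σ_j P_ab(W_j)² = 4», §4.7.5). -/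
theorem sum_norm_slot {P : κ → ι → R} (hP : IsFrame c P) (a : ι) : ∑ j, N (P j a) = c := by
  have h := hP a a
  rw [if_pos rfl] at h
  simp only [hmul] at h
  exact_mod_cast h

include hN0 hmul in
/-- Every entry of every member has norm `≤ c` («so |P_ab| ≤ 2»). -/
theorem norm_le {P : κ → ι → R} (hP : IsFrame c P) (j : κ) (a : ι) : N (P j a) ≤ c := by
  rw [← sum_norm_slot N hmul hP a]
  exact Finset.single_le_sum (fun k _ => hN0 (P k a)) (Finset.mem_univ j)

variable [DecidableEq κ]

include hN0 hmul hz in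
/-- An entry of norm `c` MONOPOLISES ITS SLOT: if `N(P_j(a)) = c` then `P_k(a) = 0` for every other member `k` («P_ab(W) = ±2
forces P_ab(W′) = 0 for every other member W′»). -/
theorem eq_zero_of_norm_eq {P : κ → ι → R} (hP : IsFrame c P) {j : κ} {a : ι} (hja : N (P j a) = c)
    {k : κ} (hk : k ≠ j) : P k a = 0 := by
  have hs := sum_norm_slot N hmul hP a
  rw [← Finset.add_sum_erase _ _ (Finset.mem_univ j), hja] at hs
  have h0 : ∑ x ∈ Finset.univ.erase j, N (P x a) = 0 := by linarith
  rw [Finset.sum_eq_zero_iff_of_nonneg (fun i _ => hN0 (P i a))] at h0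
  exact hz _ (h0 k (Finset.mem_erase.mpr ⟨hk, Finset.mem_univ k⟩))

variable [NoZeroDivisors R]

include hN0 hmul hz in
/-- … AND THEN ITS WHOLE VECTOR: if `N(P_j(a)) = c` then `P_j(b) = 0` for every other slot `b` («for cd ≠ ab the entry (ab, cd)
reads P_ab(W)·P_cd(W) + 0 = 0»; no zero divisors). -/
theorem entry_eq_zero_of_norm_eq {P : κ → ι → R} (hP : IsFrame c P) {j : κ} {a : ι} (hja : N (P j a) = c)
    {b : ι} (hb : b ≠ a) : P j b = 0 := by
  by_cases hc : c = 0
  · -- degenerate frame constant: every slot sum vanishes, so every entry does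
    have hs := sum_norm_slot N hmul hP b
    rw [hc, Nat.cast_zero, Finset.sum_eq_zero_iff_of_nonneg (fun i _ => hN0 (P i b))] at hs
    exact hz _ (hs j (Finset.mem_univ j))
  have hab := hP a b
  rw [if_neg (Ne.symm hb), ← Finset.add_sum_erase _ _ (Finset.mem_univ j)] at hab
  have hrest : ∑ x ∈ Finset.univ.erase j, P x a * star (P x b) = 0 := by
    refine Finset.sum_eq_zero (fun k hk => ?_)
    rw [eq_zero_of_norm_eq N hN0 hmul hz hP hja (Finset.mem_erase.mp hk).1, zero_mul]
  rw [hrest, add_zero] at hab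
  have hja0 : P j a ≠ 0 := by
    intro h0
    have hN00 : N 0 = 0 := by
      have h := hmul 0
      rw [zero_mul] at h
      exact_mod_cast h.symm
    rw [h0, hN00] at hja
    exact hc (by exact_mod_cast hja.symm)
  rcases mul_eq_zero.mp hab with h | h
  · exact absurd h hja0
  · exact star_eq_zero.mp h

include hN0 hmul hz in
/-- **FRAME LEMMA (abstract).** In a tight frame with constant `c ≠ 1` and PRIMITIVE members no entry has norm `c`: otherwise that
entry divides every entry of its vector (the others vanish), so it is a unit, of norm `1 ≠ c` («so P(W) = ±2·e_ab, not primitive —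
contradiction», §4.7.5; «N(P_ab) = 4 is impossible», §4.9 (5)). Hypothesis `hu`: units have norm 1. -/
theorem norm_ne_of_primitive (hu : ∀ x, IsUnit x → N x = 1) (hc1 : c ≠ 1) {P : κ → ι → R} (hP : IsFrame c P) {j : κ}
    (hprim : Primitive (P j)) (a : ι) : N (P j a) ≠ c := by
  intro hja
  have hunit : IsUnit (P j a) := by
    refine hprim (P j a) (fun b => ?_)
    by_cases hb : b = a
    · subst hb; exact dvd_rfl
    · rw [entry_eq_zero_of_norm_eq N hN0 hmul hz hP hja hb]; exact dvd_zero _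
  have h1 := hu _ hunit
  rw [h1] at hja
  exact hc1 (by exact_mod_cast hja.symm)

include hN0 hmul hz in
/-- **FRAME LEMMA (abstract), strict form:** with constant `c ≠ 1` every entry of every primitive member has norm `< c`. -/
theorem norm_lt_of_primitive (hu : ∀ x, IsUnit x → N x = 1) (hc1 : c ≠ 1) {P : κ → ι → R} (hP : IsFrame c P) {j : κ}
    (hprim : Primitive (P j)) (a : ι) : N (P j a) < c := by
  have h1 := norm_le N hN0 hmul hP j a
  have h2 := norm_ne_of_primitive N hN0 hmul hz hu hc1 hP hprim a
  omega

include hN0 hmul hz in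
/-- **FRAME LEMMA, census form (`c = 4`):** every entry of every primitive member has norm `≤ 3` («N(P_ab(W_j)) ≤ 3», §4.9 (5)). -/
theorem norm_le_three_of_primitive (hu : ∀ x, IsUnit x → N x = 1) {P : κ → ι → R} (hP : IsFrame 4 P) {j : κ}
    (hprim : Primitive (P j)) (a : ι) : N (P j a) ≤ 3 := by
  have h := norm_lt_of_primitive N hN0 hmul hz hu (by norm_num) hP hprim a
  omega

end FrameLemma

/-! ## §2 LEMMA (M), abstract form (any frame constant `c`) -/

section LemmaM

variable {R : Type*} [CommRing R] [StarRing R] [CharZero R]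
variable {ι κ : Type*} [Fintype ι] [DecidableEq ι] [Fintype κ] {c : ℕ}
variable (N : R → ℤ) (hN0 : ∀ x, 0 ≤ N x) (hmul : ∀ x, x * star x = (N x : R)) (hz : ∀ x, N x = 0 → x = 0)
variable (hNcast : ∀ m : ℤ, N (m : R) = m * m)

include hmul in
omit [CharZero R] [DecidableEq ι] in
/-- `⟨v, v⟩ = |v|²` (cast into `R`). -/
theorem pair_self (v : ι → R) : pair v v = (normSq N v : R) := by
  simp only [pair, normSq, hmul, Int.cast_sum]

include hmul in
/-- TRACE LINE: `Σ_j |P_j|² = c · #slots` (c = 4, six slots: 24, i.e. «Σ_j δ_{W_j} = 48», §4.7.5; «trace Σ|P_j|²∕4 = 24∕4 = 6», th-1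
l.7642 (iv)). -/
theorem sum_normSq_eq {P : κ → ι → R} (hP : IsFrame c P) : ∑ j, normSq N (P j) = c * Fintype.card ι := by
  simp only [normSq]
  rw [Finset.sum_comm]
  simp only [sum_norm_slot N hmul hP, Finset.sum_const, Finset.card_univ, nsmul_eq_mul]
  ring

include hmul in
/-- LEMMA (M), the identity: `Σ_j N⟨P_j, v⟩ = c·|v|²` for EVERY vector `v` («Σ_j |⟨P_j, P⟩|² = P†(Σ_j P_jP_j†)P = 4·|P|²», §4.7.6). -/
theorem sum_norm_pair_eq {P : κ → ι → R} (hP : IsFrame c P) (v : ι → R) :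
    ∑ j, N (pair (P j) v) = c * normSq N v := by
  have expand : ∀ j, pair (P j) v * star (pair (P j) v) =
      ∑ a, ∑ b, (star (v a) * v b) * (P j a * star (P j b)) := by
    intro j
    rw [pair, star_sum, Finset.sum_mul_sum]
    refine Finset.sum_congr rfl (fun a _ => Finset.sum_congr rfl (fun b _ => ?_))
    rw [star_mul', star_star]; ring
  have key : ∑ j, pair (P j) v * star (pair (P j) v) = (c : R) * (normSq N v : R) := by
    calc ∑ j, pair (P j) v * star (pair (P j) v)
        = ∑ j, ∑ a, ∑ b, (star (v a) * v b) * (P j a * star (P j b)) := Finset.sum_congr rfl (fun j _ => expand j)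
      _ = ∑ a, ∑ b, (star (v a) * v b) * ∑ j, (P j a * star (P j b)) := by
          rw [Finset.sum_comm]
          refine Finset.sum_congr rfl (fun a _ => ?_)
          rw [Finset.sum_comm]
          refine Finset.sum_congr rfl (fun b _ => ?_)
          rw [Finset.mul_sum]
      _ = ∑ a, (star (v a) * v a) * (c : R) := by
          refine Finset.sum_congr rfl (fun a _ => ?_)
          simp only [show ∀ b, ∑ j, P j a * star (P j b) = if a = b then (c : R) else 0 from fun b => hP a b,
            mul_ite, mul_zero, Finset.sum_ite_eq, Finset.mem_univ, if_true]
      _ = (c : R) * (normSq N v : R) := by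
          simp only [normSq, Int.cast_sum, Finset.mul_sum]
          refine Finset.sum_congr rfl (fun a _ => ?_)
          rw [← hmul]; ring
  simp only [hmul] at key
  exact_mod_cast key

include hN0 hz in
omit [StarRing R] [CharZero R] [DecidableEq ι] in
/-- A non-zero vector has `|v|² > 0`. -/
theorem normSq_pos {v : ι → R} (hv : v ≠ 0) : 0 < normSq N v := by
  obtain ⟨a, ha⟩ : ∃ a, v a ≠ (0 : ι → R) a := Function.ne_iff.mp hv
  have hpos : 0 < N (v a) := lt_of_le_of_ne (hN0 _) (fun h => ha (hz _ h.symm))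
  exact lt_of_lt_of_le hpos (Finset.single_le_sum (fun b _ => hN0 (v b)) (Finset.mem_univ a))

variable [DecidableEq R]

include hmul hNcast in
omit [CharZero R] [DecidableEq ι] in
/-- On the copies of `v` the pairing has norm `|v|⁴` (hypothesis `hNcast`: `N(m·1) = m²` for integers `m`). -/
theorem norm_pair_of_mem_copies {P : κ → ι → R} {v : ι → R} {j : κ} (hj : j ∈ copies P v) :
    N (pair (P j) v) = normSq N v * normSq N v := by
  have hj' : P j = v := (Finset.mem_filter.mp hj).2
  rw [hj', pair_self N hmul v, hNcast]

include hN0 hmul hNcast in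
/-- LEMMA (M), the inequality: `n_W · |P|⁴ ≤ c·|P|²` — «the n_W copies of P contribute n_W|P|⁴ and every other term is ≥ 0»
(§4.7.6; th-1 l.7642 (1)). -/
theorem card_copies_mul_le {P : κ → ι → R} (hP : IsFrame c P) (v : ι → R) :
    ((copies P v).card : ℤ) * (normSq N v * normSq N v) ≤ c * normSq N v := by
  rw [← sum_norm_pair_eq N hmul hP v]
  have hsub : ∑ j ∈ copies P v, N (pair (P j) v) ≤ ∑ j, N (pair (P j) v) :=
    Finset.sum_le_sum_of_subset_of_nonneg (Finset.subset_univ _) (fun j _ _ => hN0 _)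
  have hcop : ∑ j ∈ copies P v, N (pair (P j) v) = ((copies P v).card : ℤ) * (normSq N v * normSq N v) := by
    rw [Finset.sum_congr rfl (fun j hj => norm_pair_of_mem_copies N hmul hNcast hj), Finset.sum_const, nsmul_eq_mul]
  rw [← hcop]; exact hsub

include hN0 hmul hz hNcast in
/-- **LEMMA (M):** `n_W · |P|² ≤ c` for every non-zero vector `P` occurring `n_W` times in the frame («Hence n_W·|P|² ≤ 4», §4.7.6;
at the E₈ polarisation, after clearing the denominator 2: «LEMMA (M) reads n_W·det G_W ≤ 4», §4.10 (E8-i)). -/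
theorem card_copies_mul_normSq_le {P : κ → ι → R} (hP : IsFrame c P) {v : ι → R} (hv : v ≠ 0) :
    ((copies P v).card : ℤ) * normSq N v ≤ c := by
  have h := card_copies_mul_le N hN0 hmul hNcast hP v
  have hm := normSq_pos N hN0 hz hv
  by_contra H
  have H' := not_le.mp H
  nlinarith

include hN0 hmul hz hNcast in
/-- **LEMMA (M)(i):** every non-zero MEMBER has `|P_j|² ≤ c` — at `c = 4` with «δ_W = 2·|P(W)|²»: «EVERY MEMBER OF EVERY CLASS SOLUTION
HAS θ-DEGREE δ_W ≤ 8 — on E⁴ for every E and at the CM anchors alike, integral or not» (§4.7.6 (i)). -/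
theorem normSq_le {P : κ → ι → R} (hP : IsFrame c P) {j : κ} (hv : P j ≠ 0) : normSq N (P j) ≤ c := by
  have h := card_copies_mul_normSq_le N hN0 hmul hz hNcast hP hv
  have hc0 : 0 < (copies P (P j)).card :=
    Finset.card_pos.mpr ⟨j, Finset.mem_filter.mpr ⟨Finset.mem_univ j, rfl⟩⟩
  have hc1 : (1 : ℤ) ≤ (copies P (P j)).card := by exact_mod_cast hc0
  have hm := normSq_pos N hN0 hz hv
  nlinarith

include hN0 hmul hz hNcast in
/-- **LEMMA (M)(ii):** `n_W · δ_W ≤ 2c` with `δ_W := 2·|P|²` (c = 4: «n_W·δ_W ≤ 8: members of degree 8 or 6 are simple, a member of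
degree 4 occurs at most twice, a coordinate plane (degree 2) at most four times», §4.7.6 (ii)). -/
theorem card_copies_mul_delta_le {P : κ → ι → R} (hP : IsFrame c P) {v : ι → R} (hv : v ≠ 0) :
    ((copies P v).card : ℤ) * (2 * normSq N v) ≤ 2 * c := by
  have h := card_copies_mul_normSq_le N hN0 hmul hz hNcast hP hv
  linarith

include hmul hNcast in
/-- **LEMMA (M)(iii):** `Σ_{j not a copy of v} N⟨P_j, v⟩ = |v|²·(c − n_W·|v|²)` (§4.7.6 (iii)). -/
theorem sum_norm_pair_noncopies {P : κ → ι → R} (hP : IsFrame c P) (v : ι → R) :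
    ∑ j ∈ Finset.univ.filter (fun j => ¬ P j = v), N (pair (P j) v) =
      normSq N v * (c - ((copies P v).card : ℤ) * normSq N v) := by
  have htot := sum_norm_pair_eq N hmul hP v
  rw [← Finset.sum_filter_add_sum_filter_not Finset.univ (fun j => P j = v)] at htot
  have hcop : ∑ j ∈ copies P v, N (pair (P j) v) = ((copies P v).card : ℤ) * (normSq N v * normSq N v) := by
    rw [Finset.sum_congr rfl (fun j hj => norm_pair_of_mem_copies N hmul hNcast hj), Finset.sum_const, nsmul_eq_mul]
  change (∑ j ∈ copies P v, N (pair (P j) v)) + _ = _ at htot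
  linear_combination htot - hcop

include hN0 hmul hz hNcast in
/-- **LEMMA (M)(iii), the extremal case:** a member with `|P|² = c` (at c = 4: θ-degree 8) is hermitian-ORTHOGONAL to every other
member: `⟨P_j, P⟩ = 0` whenever `P_j ≠ P` («in particular a member of degree 8 has Plücker vector HERMITIAN-ORTHOGONAL to that of
every other member», §4.7.6 (iii); «= 0 at δ = 8», th-1 l.7642). -/
theorem pair_eq_zero_of_normSq_eq {P : κ → ι → R} (hP : IsFrame c P) {j₀ j : κ} (hmax : normSq N (P j₀) = c)
    (hj : ¬ P j = P j₀) : pair (P j) (P j₀) = 0 := by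
  have hS := sum_norm_pair_noncopies N hmul hNcast hP (P j₀)
  have hc0 : 0 < (copies P (P j₀)).card :=
    Finset.card_pos.mpr ⟨j₀, Finset.mem_filter.mpr ⟨Finset.mem_univ j₀, rfl⟩⟩
  have hc1 : (1 : ℤ) ≤ (copies P (P j₀)).card := by exact_mod_cast hc0
  have hge : ∀ k ∈ Finset.univ.filter (fun k => ¬ P k = P j₀), 0 ≤ N (pair (P k) (P j₀)) := fun k _ => hN0 _
  have hle : ∑ k ∈ Finset.univ.filter (fun k => ¬ P k = P j₀), N (pair (P k) (P j₀)) ≤ 0 := by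
    rw [hS, hmax]
    have hcc : (0 : ℤ) ≤ (c : ℤ) * c := mul_self_nonneg _
    nlinarith
  have h0 := le_antisymm hle (Finset.sum_nonneg hge)
  rw [Finset.sum_eq_zero_iff_of_nonneg hge] at h0
  exact hz _ (h0 j (Finset.mem_filter.mpr ⟨Finset.mem_univ j, hj⟩))

end LemmaM

/-! ## §3 LEMMA (M)(iv): the Gram form, and the matrix reading of `IsFrame` -/

section Gram

variable {R : Type*} [CommRing R] [StarRing R] {ι κ : Type*} [Fintype κ] {c : ℕ}

/-- `IsFrame c P` is literally `A·A† = c·I` for the member matrix `A`. -/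
theorem isFrame_iff_matrix [DecidableEq ι] (P : κ → ι → R) :
    IsFrame c P ↔ memberMatrix P * (memberMatrix P)ᴴ = (c : R) • (1 : Matrix ι ι R) := by
  constructor
  · intro hP
    ext a b
    simp only [Matrix.mul_apply, memberMatrix, Matrix.of_apply, Matrix.conjTranspose_apply, Matrix.smul_apply,
      Matrix.one_apply, smul_eq_mul, mul_ite, mul_one, mul_zero]
    exact hP a b
  · intro h a b
    have hab := congr_fun (congr_fun h a) b
    simpa only [Matrix.mul_apply, memberMatrix, Matrix.of_apply, Matrix.conjTranspose_apply, Matrix.smul_apply,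
      Matrix.one_apply, smul_eq_mul, mul_ite, mul_one, mul_zero] using hab

omit [Fintype κ] in
/-- The entries of the GRAM MATRIX `Γ := A†A` are the pairings: `Γ_{jk} = Σ_a star(P_j(a))·P_k(a)`. -/
theorem gram_apply [Fintype ι] (P : κ → ι → R) (j k : κ) :
    ((memberMatrix P)ᴴ * memberMatrix P) j k = ∑ a, star (P j a) * P k a := by
  simp only [Matrix.mul_apply, memberMatrix, Matrix.of_apply, Matrix.conjTranspose_apply]

/-- **LEMMA (M)(iv), GRAM FORM** (any star-ring, any sizes, any scalar `r`): `A·A† = r·I ⇒ (A†A)·(A†A) = r·(A†A)` — «Γ/4 is the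
orthogonal projector … [A := (P_1 … P_m), AA† = 4·I₆ ⇒ (A†A)² = 4·A†A]» (§4.7.6 (iv); th-1 l.7642 (iv)). -/
theorem gram_mul_gram [Fintype ι] [DecidableEq ι] (A : Matrix ι κ R) (r : R) (h : A * Aᴴ = r • (1 : Matrix ι ι R)) :
    (Aᴴ * A) * (Aᴴ * A) = r • (Aᴴ * A) := by
  calc (Aᴴ * A) * (Aᴴ * A) = Aᴴ * ((A * Aᴴ) * A) := by simp only [Matrix.mul_assoc]
    _ = r • (Aᴴ * A) := by rw [h, Matrix.smul_mul, Matrix.one_mul, Matrix.mul_smul]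

end Gram

end Summit.Ventures.HSemireg.FlatFrame
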